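import Summits.QuantumFields.BalabanUV.Beta.GAN24.TaylorTrilinear
import Summits.QuantumFields.BalabanUV.Beta.GAN24.ScaleNesting

/-!
# `BalabanUV.Beta.GAN24.TaylorTrilinearCarry` — binder row G-an2-4 ∕ (CONV-C), S-slot, road «S3-Taylor», DIFF row R3-dW:
# generic leaf, PART 1 of 7 — CARRIES OF A CELL: integer division by the scale factor, HERMITE'S IDENTITY per coordinate,
# transport of a coarse leg to the finer lattice

G-an2-4 formalisation swarm, leaf prover 15 (unit `b2b-balaban-gan24-formalise-leaf-15`, gen 14; DIFF row R3-dW holder, INTENT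
CLAIMS.log l.4908).  HONEST FRAMING (cell rule, verbatim): «discharging `BetaPertH` makes Bałaban's UV stability UNCONDITIONAL — a
real constructive-QFT result; it is NOT the continuum limit and NOT the Clay problem.»  HONEST DEPENDENCY (verbatim): «continuum YM
on T⁴ ⇐ BetaPertH ∧ nine spine estimates (0/9 proved); BetaPertH ⇐ (D1) ∧ (D4) ∧ CAP+tail; G-an2-4 gates asym, D1 and NE2/3/4.»
NOT IN PRINT; OUR BOOKKEEPING ([folklore]): elementary real analysis ∕ finite algebra on `ℤ^{d+1}`, GENERIC `d`, GENERIC blockings,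
ABSTRACT legs and table; NO object of an2's typed `U = 1` system occurs, nothing is cited, no `def … : Prop`, NOTHING is asserted
or discharged of «E3Shape»∕«E3SupRate» (OPEN, not in print), of (hS, hSall), of the K-slot, of `BetaPertH`.
NOT BetaPertH, NOT continuum, NOT Clay.

CONTEXT (asserted nowhere below).  The RATE table of the S-slot (`GAN24/StencilSlotE3RateOfPieces.e3SupRate_of_pieces`,
row owner gan24-p1) has the DIFFERENCE row R3-dW: the Wilson piece of the normalised third jet at member `n+3` (blocking
`N′ = N·Lc`) minus the one at member `n+2` (blocking `N`), `≤ cW·θ^{n+1}`.  By `E3UnitSplit.e3W_unit_split` both are (at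
`d = 3`, residual `1`) the SAME unit sandwich functional — three legs, one block average, ONE explicit factor of the blocking
on the SAME translation-invariant zero-row-sum table `wilsonA` — read at two blockings.  This chain of generic leaves
(`TaylorTrilinearCarry` ∕ `…Pairing` ∕ `…DiffSlices` ∕ `…DiffSummed` ∕ `…Transport` ∕ `…TransportBound` ∕ `…Diff`) proves the
two-level difference bound `TaylorTrilinearDiff.trilinear_diff_bound`: TRANSPORT the level-`N` legs to the finer lattice by
`quo Lc` (piecewise constant on cells), split trilinearly — the couplings «(N1-Cauchy)» enter BY THEIR SUP ONLY thanks to ONE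
ABEL SUMMATION in the vertex location — and compare the transported functional with the original one EXACTLY through the
CARRY TABLE of a cell (Hermite's identity: same row sum, same first moments ⇒ second order ⇒ `O(1/N)` by the pairing lemma).

## What is proved ([folklore], `0 sorry`; `quo` = `LatticeForm.quo`, `box`∕`toSite` = `AffineAveraging.box`∕`toSite`)
* §1 `ediv_add_one_eq_or` (a unit step moves `⌊·/L⌋` by 0 or 1), `abs_ediv_box_add_le` (`|⌊(r+s)/L⌋| ≤ |s|` for `0 ≤ r < L`),
  `sum_range_ediv_box`, **`sum_range_ediv_add_eq`** (HERMITE: `Σ_{r<L} ⌊(r+s)/L⌋ = s`, every integer `s`).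
* §2 `quo_add_single`, `quo_cell_add` (`quo L (L•v + r + s) = v + quo L (r + s)` — the CARRY of the offset `s` at the cell
  position `r`), `mem_box_iff`, `l1_quo_toSite_add_le` ∕ `natl1_quo_toSite_add_le` (carries are no longer than offsets),
  `card_box_filter_eq`, **`sum_box_quo_toSite_add`** (`Σ_{r ∈ box} (quo L (r+s)) j = L^d · s j`).
* §3 `transport_decay`, `transport_unit_step`: `F ∘ quo L` inherits block-label decay verbatim (`ScaleNesting.quo_mul`) and unit
  gradients with constant `L·C′` at blocking `L·N`.
-/

noncomputable section

open Finset
open scoped BigOperators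
open Literature.MathematicalPhysics.QuantumFieldTheory Balaban1983to89 Balaban1983to89.Beta
open B12Sec2to5 (l1 l1_nonneg)
open ExpKernelCalculus (Zl l1_sub_triangle l1_sub_symm)
open LatticeForm (quo)
open BlochFibreUniqueness (quo_add_zsmul)
open KKTFluctuationEnergy (tsum_blocks quo_zsmul_add_toSite)
open AffineAveraging (box toSite)

namespace Summit.QuantumFields.BalabanUV.Beta.GAN24.TaylorTrilinearCarry

open Summit.QuantumFields.BalabanUV.Beta.GAN24.TaylorTrilinearLattice
open Summit.QuantumFields.BalabanUV.Beta.GAN24.ScaleNesting (quo_mul)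

variable {d : ℕ}

/-! ## §1 Integer division by the scale factor `L`: unit steps, carries, Hermite's identity -/

/-- [folklore] A unit step moves the `L`-block index by `0` or `1`: `(a+1)/L = a/L ∨ (a+1)/L = a/L + 1` (`L ≥ 1`). -/
theorem ediv_add_one_eq_or {L : ℤ} (hL : 0 < L) (a : ℤ) :
    (a + 1) / L = a / L ∨ (a + 1) / L = a / L + 1 := by
  have h1 : a / L ≤ (a + 1) / L := Int.ediv_le_ediv hL (by omega)
  have h2 : (a + 1) / L ≤ a / L + 1 := by
    have : (a + 1) / L ≤ (a + 1 * L) / L := Int.ediv_le_ediv hL (by nlinarith)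
    rwa [Int.add_mul_ediv_right _ _ hL.ne'] at this
  omega

/-- [folklore] Carries are bounded by the offset: `|(r + s)/L| ≤ |s|` for a box coordinate `0 ≤ r < L`. -/
theorem abs_ediv_box_add_le {L : ℤ} (hL : 0 < L) {r : ℤ} (hr0 : 0 ≤ r) (hrL : r < L) (s : ℤ) :
    |(r + s) / L| ≤ |s| := by
  rcases le_or_gt 0 s with hs | hs
  · have h0 : 0 ≤ (r + s) / L := Int.ediv_nonneg (by omega) hL.le
    have h1 : (r + s) / L ≤ s := by
      have : (r + s) / L < s + 1 := by
        rw [Int.ediv_lt_iff_lt_mul hL]; nlinarith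
      omega
    rw [abs_of_nonneg h0, abs_of_nonneg hs]; exact h1
  · have h0 : (r + s) / L ≤ 0 := by
      have : (r + s) / L < 1 := by rw [Int.ediv_lt_iff_lt_mul hL]; omega
      omega
    have h1 : s ≤ (r + s) / L := by
      rw [Int.le_ediv_iff_mul_le hL]; nlinarith
    rw [abs_of_nonpos h0, abs_of_neg hs]; omega

/-- [folklore] The box part of Hermite's identity: for `0 ≤ m < L`, `#{r < L : L ≤ r + m} = m`, i.e.
`Σ_{r<L} (r + m)/L = m`. -/
theorem sum_range_ediv_box {L : ℕ} (hL : 0 < L) {m : ℤ} (hm0 : 0 ≤ m) (hmL : m < L) :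
    ∑ r ∈ Finset.range L, (((r : ℕ) : ℤ) + m) / (L : ℤ) = m := by
  have hLz : (0 : ℤ) < L := by exact_mod_cast hL
  -- each summand is the indicator of `L ≤ r + m`
  have hterm : ∀ r ∈ Finset.range L, (((r : ℕ) : ℤ) + m) / (L : ℤ) = if L ≤ r + m.toNat then 1 else 0 := by
    intro r hr
    have hr' : r < L := Finset.mem_range.1 hr
    have hmto : (m.toNat : ℤ) = m := Int.toNat_of_nonneg hm0
    split_ifs with h
    · have h' : (L : ℤ) ≤ (r : ℤ) + m := by rw [← hmto]; exact_mod_cast h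
      have e : ((r : ℤ) + m) = ((r : ℤ) + m - L) + 1 * (L : ℤ) := by ring
      rw [e, Int.add_mul_ediv_right _ _ hLz.ne', Int.ediv_eq_zero_of_lt (by omega) (by omega), zero_add]
    · have h' : (r : ℤ) + m < L := by
        rw [← hmto]; exact_mod_cast (not_le.1 h)
      exact Int.ediv_eq_zero_of_lt (by omega) h'
  rw [Finset.sum_congr rfl hterm, Finset.sum_boole]
  have hfilter : (Finset.range L).filter (fun r => L ≤ r + m.toNat) = Finset.Ico (L - m.toNat) L := by
    ext r
    simp only [Finset.mem_filter, Finset.mem_range, Finset.mem_Ico]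
    omega
  rw [hfilter, Nat.card_Ico]
  have hmn : m.toNat < L := by
    have := Int.toNat_of_nonneg hm0; omega
  rw [show L - (L - m.toNat) = m.toNat by omega]
  exact Int.toNat_of_nonneg hm0

/-- [folklore] **HERMITE'S IDENTITY** for the `L`-carries of an integer offset: `Σ_{r<L} (r + s)/L = s` (every `s : ℤ`;
write `s = (s % L) + L·(s / L)` and count the box carries with `sum_range_ediv_box`). -/
theorem sum_range_ediv_add_eq {L : ℕ} (hL : 0 < L) (s : ℤ) :
    ∑ r ∈ Finset.range L, (((r : ℕ) : ℤ) + s) / (L : ℤ) = s := by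
  have hLz : (0 : ℤ) < L := by exact_mod_cast hL
  have hs : s % L + L * (s / L) = s := Int.emod_add_mul_ediv s L
  have hterm : ∀ r ∈ Finset.range L,
      (((r : ℕ) : ℤ) + s) / (L : ℤ) = (((r : ℕ) : ℤ) + s % L) / (L : ℤ) + s / L := by
    intro r _
    have e : ((r : ℕ) : ℤ) + s = (((r : ℕ) : ℤ) + s % L) + (s / L) * (L : ℤ) := by
      nth_rewrite 1 [← hs]; ring
    rw [e, Int.add_mul_ediv_right _ _ hLz.ne']
  rw [Finset.sum_congr rfl hterm, Finset.sum_add_distrib, Finset.sum_const, Finset.card_range,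
    sum_range_ediv_box hL (Int.emod_nonneg s hLz.ne') (Int.emod_lt_of_pos s hLz), nsmul_eq_mul]
  linarith

/-! ## §2 Lattice form: `L`-block indices of unit steps and of cell points, carries of a cell, Hermite per coordinate -/

/-- [folklore] A unit lattice step moves the `L`-block index by `0` or by the same unit step. -/
theorem quo_add_single (L : ℕ) [NeZero L] (w : Fin (d + 1) → ℤ) (ν : Fin (d + 1)) :
    quo L (w + Pi.single ν 1) = quo L w ∨ quo L (w + Pi.single ν 1) = quo L w + Pi.single ν 1 := by
  have hL : (0 : ℤ) < L := by exact_mod_cast Nat.pos_of_ne_zero (NeZero.ne L)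
  rcases ediv_add_one_eq_or hL (w ν) with h | h
  · left
    funext j
    by_cases hj : j = ν
    · subst hj; simp only [quo, Pi.add_apply, Pi.single_eq_same, h]
    · simp only [quo, Pi.add_apply, Pi.single_eq_of_ne hj, add_zero]
  · right
    funext j
    by_cases hj : j = ν
    · subst hj; simp only [quo, Pi.add_apply, Pi.single_eq_same, h]
    · simp only [quo, Pi.add_apply, Pi.single_eq_of_ne hj, add_zero]

/-- [folklore] The `L`-block index of a cell point plus an offset: `quo L (L•v + r + s) = v + quo L (r + s)` — the
CARRY `quo L (r + s)` of the offset `s` at the cell position `r`. -/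
theorem quo_cell_add (L : ℕ) [NeZero L] (v : Fin (d + 1) → ℤ) (r : Fin (d + 1) → ℕ) (s : Fin (d + 1) → ℤ) :
    quo L ((L : ℤ) • v + toSite r + s) = v + quo L (toSite r + s) := by
  have e : (L : ℤ) • v + toSite r + s = (toSite r + s) + (L : ℤ) • v := by abel
  rw [e, quo_add_zsmul]; exact add_comm _ _

/-- [folklore] Box membership, coordinatewise. -/
theorem mem_box_iff {L : ℕ} {r : Fin (d + 1) → ℕ} : r ∈ box (d + 1) L ↔ ∀ j, r j < L := by
  simp only [AffineAveraging.box, Fintype.mem_piFinset, Finset.mem_range]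

/-- [folklore] Carries are no longer than the offset: `|quo L (r + s)|₁ ≤ |s|₁` for `r` in the cell box. -/
theorem l1_quo_toSite_add_le (L : ℕ) [NeZero L] {r : Fin (d + 1) → ℕ} (hr : r ∈ box (d + 1) L)
    (s : Fin (d + 1) → ℤ) : l1 (quo L (toSite r + s)) ≤ l1 s := by
  have hL : (0 : ℤ) < L := by exact_mod_cast Nat.pos_of_ne_zero (NeZero.ne L)
  unfold l1
  refine Finset.sum_le_sum fun j _ => ?_
  have h := abs_ediv_box_add_le hL (r := (r j : ℤ)) (by positivity) (by exact_mod_cast (mem_box_iff.1 hr j)) (s j)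
  have h' : ((|((r j : ℤ) + s j) / (L : ℤ)| : ℤ) : ℝ) ≤ ((|s j| : ℤ) : ℝ) := by exact_mod_cast h
  simpa only [quo, toSite, Pi.add_apply, Int.cast_abs] using h'

/-- [folklore] Carries are no longer than the offset, `ℕ`-valued form: `|quo L (r + s)|₁ ≤ |s|₁`. -/
theorem natl1_quo_toSite_add_le (L : ℕ) [NeZero L] {r : Fin (d + 1) → ℕ} (hr : r ∈ box (d + 1) L)
    (s : Fin (d + 1) → ℤ) : LatticeForm.l1 (quo L (toSite r + s)) ≤ LatticeForm.l1 s := by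
  have h := l1_quo_toSite_add_le L hr s
  rw [← cast_natl1, ← cast_natl1] at h
  exact_mod_cast h

/-- [folklore] Each coordinate fibre of the cell box has `L^d` points. -/
theorem card_box_filter_eq (L : ℕ) (j : Fin (d + 1)) {a : ℕ} (ha : a < L) :
    ((box (d + 1) L).filter fun r => r j = a).card = L ^ d := by
  classical
  have hmem : a ∈ (fun _ : Fin (d + 1) => Finset.range L) j := Finset.mem_range.2 ha
  have h := Fintype.piFinset_update_singleton_eq_filter_piFinset_eq (fun _ : Fin (d + 1) => Finset.range L) j hmem
  unfold AffineAveraging.box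
  rw [← h, Fintype.card_piFinset]
  have hfun : (fun i => (Function.update (fun _ : Fin (d + 1) => Finset.range L) j {a} i).card) =
      Function.update (fun _ : Fin (d + 1) => L) j 1 := by
    funext i
    by_cases hi : i = j
    · subst hi; simp
    · simp [Function.update_of_ne hi]
  rw [hfun, Finset.prod_update_of_mem (Finset.mem_univ j), one_mul, Finset.prod_const]
  congr 1
  rw [Finset.card_sdiff_of_subset (Finset.subset_univ _), Finset.card_univ, Fintype.card_fin, Finset.card_singleton]
  omega

/-- [folklore] **HERMITE PER COORDINATE OVER THE CELL**: `Σ_{r ∈ box} (quo L (r + s)) j = L^d · s j` — the carries of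
the offset `s` over one `L`-cell add up to `L^d` copies of `s` (coordinate `j`: `L^d` fibres × Hermite's identity). -/
theorem sum_box_quo_toSite_add (L : ℕ) [NeZero L] (s : Fin (d + 1) → ℤ) (j : Fin (d + 1)) :
    ∑ r ∈ box (d + 1) L, quo L (toSite r + s) j = (L : ℤ) ^ d * s j := by
  classical
  have hL : 0 < L := Nat.pos_of_ne_zero (NeZero.ne L)
  set f : ℕ → ℤ := fun a => ((a : ℤ) + s j) / (L : ℤ) with hf
  have hcoord : ∀ r : Fin (d + 1) → ℕ, quo L (toSite r + s) j = f (r j) := by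
    intro r; simp only [hf, quo, toSite, Pi.add_apply]
  rw [Finset.sum_congr rfl fun r _ => hcoord r, Finset.sum_comp]
  have himg : (AffineAveraging.box (d + 1) L).image (fun r => r j) = Finset.range L := by
    unfold AffineAveraging.box
    exact Fintype.eval_image_piFinset_const _ j
  rw [himg]
  calc ∑ a ∈ Finset.range L, ((AffineAveraging.box (d + 1) L).filter fun r => r j = a).card • f a
      = ∑ a ∈ Finset.range L, (L : ℤ) ^ d * ((((a : ℕ) : ℤ) + s j) / (L : ℤ)) := by
        refine Finset.sum_congr rfl fun a ha => ?_
        rw [card_box_filter_eq L j (Finset.mem_range.1 ha), nsmul_eq_mul, hf]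
        push_cast; ring
    _ = (L : ℤ) ^ d * s j := by rw [← Finset.mul_sum, sum_range_ediv_add_eq hL]

/-! ## §3 Transport of a level-`N` leg to the finer lattice: `F̂ w := F (quo L w)` inherits decay and unit gradients -/

/-- [folklore] **TRANSPORTED DECAY**: a block-label bound at blocking `N` read through `quo L` is a block-label bound at
blocking `L·N` (`quo (L·N) = quo N ∘ quo L`, `ScaleNesting.quo_mul`). -/
theorem transport_decay {L N N' : ℕ} (hN' : N' = L * N) {F : (Fin (d + 1) → ℤ) → ℝ} {C δ : ℝ}
    {p : Fin (d + 1) → ℤ} (hF : ∀ v, |F v| ≤ C * Real.exp (-δ * l1 (quo N v - p))) (w : Fin (d + 1) → ℤ) :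
    |F (quo L w)| ≤ C * Real.exp (-δ * l1 (quo N' w - p)) := by
  rw [hN', quo_mul]; exact hF _

/-- [folklore] **TRANSPORTED UNIT GRADIENTS**: if the unit forward differences of `F` at blocking `N` are `≤ (C′/N)·weight`,
those of `F ∘ quo L` at blocking `N′ = L·N` are `≤ (L·C′/N′)·weight` — a unit step of the transported leg is `0` or ONE unit
step of `F` (`quo_add_single`). -/
theorem transport_unit_step {L N N' : ℕ} [NeZero L] [NeZero N] (hN' : N' = L * N) {F : (Fin (d + 1) → ℤ) → ℝ}
    {C' δ : ℝ} {p : Fin (d + 1) → ℤ} (hC' : 0 ≤ C')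
    (hF : ∀ v ν, |F (v + Pi.single ν 1) - F v| ≤ C' / N * Real.exp (-δ * l1 (quo N v - p)))
    (w : Fin (d + 1) → ℤ) (ν : Fin (d + 1)) :
    |F (quo L (w + Pi.single ν 1)) - F (quo L w)| ≤ (L * C') / N' * Real.exp (-δ * l1 (quo N' w - p)) := by
  have hL : (0 : ℝ) < L := by exact_mod_cast Nat.pos_of_ne_zero (NeZero.ne L)
  have hN : (0 : ℝ) < N := by exact_mod_cast Nat.pos_of_ne_zero (NeZero.ne N)
  have hLC : (L * C') / N' = C' / N := by
    rw [hN']; push_cast; field_simp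
  rw [hLC, hN', quo_mul]
  rcases quo_add_single L w ν with h | h
  · rw [h, sub_self, abs_zero]; positivity
  · rw [h]; exact hF _ ν

end Summit.QuantumFields.BalabanUV.Beta.GAN24.TaylorTrilinearCarry

end
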